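import Summits.CriticalPhenomena.PercolationContinuityZ3.Theses.PercNearOneGluing
import Literature.Probability.Percolation.PercolationProofs

/-!
# The many-finger large-pocket residual is implied by `NearOneGluing`
# (so it is not a strengthening of `NoHeavyLowerTail`)

The many-finger large-pocket residual (ε–δ form; see `noHeavyLowerTail_of_manyFingersLargePocket`,
`…NoHeavyLowerTailReduction.lean`, for the converse direction residual ⇒ `NoHeavyLowerTail`) follows from
`NearOneGluing` (Kozma–Nitzan Conjecture 3) at `b := a₀ ∈ A`: the residual event lies inside `{o ↮ a₀}`.
Since `NoHeavyLowerTail` implies `NearOneGluing` (`noHeavyLowerTailSuffices_proof`), the residual is EQUIVALENT to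
`NoHeavyLowerTail` — it cannot be false unless KN Conjecture 3 is.
-/

namespace Summit.CriticalPhenomena.PercolationContinuityZ3.Theorems

open scoped Classical BigOperators
open MeasureTheory Set
open Literature.Probability.LatticeModels (prodBernoulli)
open Literature.Probability.Percolation (openConn openConnIn BondConfig measurableSet_openConn_holds)
open Summit.CriticalPhenomena.PercolationContinuityZ3.Theses.PercNearOneGluing (NearOneGluing)

/-- **The many-finger large-pocket residual follows from `NearOneGluing`** (KN Conjecture 3 at `b := a₀`): given
`ε`, take `δ` from `NearOneGluing` at `ε` and use `δ/2`; pairwise `δ/2`-reliability of `A` and `P(o ↮ A) ≤ δ/2`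
give the strict hypotheses of `NearOneGluing`, whence `P(o ↮ a₀) < ε`, and the residual event lies in `{o ↮ a₀}`
(any `d₀, s₀`; here `0, 0`). -/
theorem manyFingersLargePocket_of_nearOneGluing :
    Summit.CriticalPhenomena.PercolationContinuityZ3.Theses.PercNearOneGluing.NearOneGluing → (∀ ε :
      ℝ, 0 < ε → ∃ (δ : ℝ) (d₀ s₀ : ℕ), 0 < δ ∧ ∀ (n : ℕ) (w : Sym2 (Fin n) → unitInterval) (A :
      Finset (Fin n)) (o a₀ : Fin n), a₀ ∈ A → o ∉ A → (∀ a ∈ A, ∀ a' ∈ A,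
      (Literature.Probability.LatticeModels.prodBernoulli w).real
      (Literature.Probability.Percolation.openConn a a')ᶜ ≤ δ) →
      (Literature.Probability.LatticeModels.prodBernoulli w).real (⋃ a ∈ A,
      Literature.Probability.Percolation.openConn o a)ᶜ ≤ δ →
      (Literature.Probability.LatticeModels.prodBernoulli w).real {ω :
      Literature.Probability.Percolation.BondConfig (Fin n) | ω ∉
      Literature.Probability.Percolation.openConn o a₀ ∧ s₀ ≤ ((A.erase a₀).filter fun a => ω ∈
      Literature.Probability.Percolation.openConn o a).card ∧ 2 * ((A.erase a₀).filter fun a => ω ∈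
      Literature.Probability.Percolation.openConn o a).card ≤ A.card ∧ d₀ < (A.filter fun a => ω ∈
      Literature.Probability.Percolation.openConnIn ((↑A : Set (Fin n))ᶜ ∪ {o, a}) o a).card} ≤ ε) := by
  intro hX ε hε
  obtain ⟨δ, hδ, h⟩ := hX ε hε
  refine ⟨δ / 2, 0, 0, by positivity, fun n w A o a₀ ha₀ _ hpair hobs => ?_⟩
  have hU : 1 - δ < (prodBernoulli w).real (⋃ a ∈ A, openConn o a) := by
    have hc := probReal_compl_eq_one_sub (μ := prodBernoulli w)
      (Finset.measurableSet_biUnion A fun a _ => measurableSet_openConn_holds o a)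
    rw [hc] at hobs
    linarith
  have hrel : ∀ a ∈ A, 1 - δ < (prodBernoulli w).real (openConn a a₀) := by
    intro a ha
    have hc := probReal_compl_eq_one_sub (μ := prodBernoulli w) (measurableSet_openConn_holds a a₀)
    have := hpair a ha a₀ ha₀
    rw [hc] at this
    linarith
  have key := h n w A o a₀ hU hrel
  have hc := probReal_compl_eq_one_sub (μ := prodBernoulli w) (measurableSet_openConn_holds o a₀)
  calc (prodBernoulli w).real {ω : BondConfig (Fin n) | ω ∉ openConn o a₀ ∧
            0 ≤ ((A.erase a₀).filter fun a => ω ∈ openConn o a).card ∧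
            2 * ((A.erase a₀).filter fun a => ω ∈ openConn o a).card ≤ A.card ∧
            0 < (A.filter fun a => ω ∈ openConnIn ((↑A : Set (Fin n))ᶜ ∪ {o, a}) o a).card}
        ≤ (prodBernoulli w).real (openConn o a₀)ᶜ := measureReal_mono fun ω hω => hω.1
    _ ≤ ε := by rw [hc]; linarith

end Summit.CriticalPhenomena.PercolationContinuityZ3.Theorems
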